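import Literature.NumberTheory.Transcendental.ShuffleAlgebra
import Literature.NumberTheory.Transcendental.MZVShuffleRegularisation
import HarnessLib

/-!
# IKZ's explicit shuffle regularisation is a shuffle homomorphism onto `𝔥⁰`

Sibling proof file of `Literature.NumberTheory.Transcendental.MZVShuffleRegularisation`
(theorems only: no definition, no statement change, no named fact). That file DEFINES the
two-sided shuffle regularisation `MZV.shuffleReg : ℚ⟨x,y⟩ → 𝔥⁰` of a binary word by the explicit
formula of [IharaKanekoZagier2006, Cor. 5] (`regFront`: `Σ_i (-1)ⁱ yⁱ ш (w minus its first i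
letters)`, `regEnd`: the mirror image, `shuffleReg = regFront ∘ regEnd`) and leaves its two
structural properties — announced there as "NOT proved here (wanted by the route …):
multiplicativity `reg(u ш v) = reg(u) ш reg(v)`" and membership in `𝔥⁰` — to be supplied. Both are
proved here, by identifying the three maps coefficientwise with the Taylor (constant-term) maps of
the derivations `∂ₓ` (remove a final `x`) and `ᵧ∂` (remove an initial `y`) of the completed shuffle
algebra (`ShuffleAlgebra.lean`):

* `ShuffleAlgebra.regEnd_apply`, `regFront_apply`, `shuffleReg_apply` — `MZV.regEnd w`,
  `MZV.regFront w`, `MZV.shuffleReg w` are `τ^{end}(w)`, `τ^{front}(w)`, `reg w = τ^{front}(τ^{end} w)`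
  (the letter-block bookkeeping `w = u₀ x^{trailingX w}`, `w = y^{leadingY w} w₀` of Cor. 5);
* `MZV.sum_map_shuffleReg_apply` — **`reg` is a `ш`-homomorphism**:
  `Σ_{w ∈ u ш v} reg(w) = reg(u) ш reg(v)` coefficientwise
  (`(reg u ш reg v)(r) = Σ_{(p,q) ∈ deshuffle r} reg(u)(p) reg(v)(q)`), from
  `ShuffleAlgebra.reg_mul` [IharaKanekoZagier2006, §3 p. 314: "`reg_ш` … is an algebra
  homomorphism"];
* `MZV.shuffleRegFS_shuffleSum` — the same in the Finsupp language of the definitions file: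
  `shuffleRegFS (shuffleSum u v) = shuffleFS (shuffleReg u) (shuffleReg v)`;
* `MZV.isConvergentWord_of_mem_support_shuffleReg` — **`reg` lands in `𝔥⁰`**: every word in the
  support of `shuffleReg w` is convergent [IharaKanekoZagier2006, §3 p. 314]; and
  `MZV.length_le_of_mem_support_shuffleReg` (supports have the length of `w` at most).

These are the algebraic half of the regularised shuffle relations of multiple zeta values
(`DrinfeldAssociatorProofs.lean`: group-likeness of `Φ_KZ`).

## References

* K. Ihara, M. Kaneko, D. Zagier, *Derivation and double shuffle relations for multiple zeta
  values*, Compositio Math. 142 (2006), §3 p. 314 (`reg_ш`), Cor. 5 p. 322. [IharaKanekoZagier2006]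
* C. Reutenauer, *Free Lie Algebras* (1993), §1.4, §6. [Reutenauer1993]
-/

noncomputable section

open scoped BigOperators

namespace Literature.NumberTheory.Transcendental

namespace ShuffleAlgebra

section Reg

open MZV

/-- **`reg` lands in `𝔥⁰`**: a word with a non-zero coefficient in `reg w` is convergent (empty, or
begins with `x` and ends with `y`). [cite: IharaKanekoZagier2006, §3 p. 314] -/
theorem isConvergentWord_of_reg_apply_ne_zero {w v : List Bool} (h : reg w v ≠ 0) :
    IsConvergentWord v := by
  rcases List.eq_nil_or_concat v with rfl | ⟨v', d, rfl⟩
  · exact Or.inl rfl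
  · rw [List.concat_eq_append] at h ⊢
    right
    cases d with
    | false => exact absurd (reg_apply_append_false w v') h
    | true =>
      refine ⟨?_, by simp⟩
      cases v' with
      | nil => exact absurd (reg_apply_cons_true w []) h
      | cons c v'' =>
        cases c with
        | true => exact absurd (reg_apply_cons_true w (v'' ++ [true])) h
        | false => rfl

/-! ### Identification with `MZV.regEnd`, `MZV.regFront`, `MZV.shuffleReg` -/

/-- `MZV.wordSum L` is `Σ_{w ∈ L} w`, coefficientwise. [folklore] -/
theorem wordSum_apply (L : List (List Bool)) (v : List Bool) :
    MZV.wordSum L v = ((L.map word).sum : ShuffleAlgebra Bool ℚ) v := by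
  induction L with
  | nil => simp
  | cons w L ih =>
    rw [MZV.wordSum_cons, Finsupp.add_apply, ih, List.map_cons, List.sum_cons, add_apply,
      Finsupp.single_apply, word_apply]
    by_cases h : v = w
    · subst h; simp
    · rw [if_neg h, if_neg (Ne.symm h)]

/-- `MZV.shuffleSum u u'` is the shuffle product `u ш u'`, coefficientwise. [folklore] -/
theorem shuffleSum_apply (u u' v : List Bool) :
    MZV.shuffleSum u u' v = (word u * word u' : ShuffleAlgebra Bool ℚ) v := by
  rw [MZV.shuffleSum, wordSum_apply, word_mul_word]

/-- `takeWhile (¬·)` of a binary list is a block of `false`s. [folklore] -/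
theorem takeWhile_not_eq_replicate : ∀ l : List Bool,
    l.takeWhile (fun b => !b) = List.replicate (l.takeWhile fun b => !b).length false
  | [] => rfl
  | false :: l => by
    simpa [List.takeWhile_cons, List.replicate_succ] using takeWhile_not_eq_replicate l
  | true :: l => by simp

/-- `dropWhile (¬·)` of a binary list does not begin with `false`. [folklore] -/
theorem head?_dropWhile_not_ne : ∀ l : List Bool, (l.dropWhile fun b => !b).head? ≠ some false
  | [] => by simp
  | false :: l => by simpa [List.dropWhile_cons] using head?_dropWhile_not_ne l
  | true :: l => by simp

/-- Structure of a word along its trailing block of `x`'s: `w = u₀ x^{trailingX w}` with `u₀` not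
ending in `x`. [cite: IharaKanekoZagier2006, Cor. 5 (w = yᵐ w₀, mirror image)] -/
theorem eq_append_replicate_trailingX (w : List Bool) :
    ∃ u₀ : List Bool, w = u₀ ++ List.replicate (trailingX w) false ∧ u₀.getLast? ≠ some false := by
  refine ⟨(w.reverse.dropWhile fun b => !b).reverse, ?_, ?_⟩
  · have h := congrArg List.reverse
      (List.takeWhile_append_dropWhile (p := fun b => !b) (l := w.reverse))
    rw [List.reverse_reverse, List.reverse_append, takeWhile_not_eq_replicate,
      List.reverse_replicate] at h
    exact h.symm
  · rw [List.getLast?_reverse]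
    exact head?_dropWhile_not_ne _

/-- `trailingX w ≤ |w|`. [folklore] -/
theorem trailingX_le_length (w : List Bool) : trailingX w ≤ w.length := by
  obtain ⟨u₀, hw, -⟩ := eq_append_replicate_trailingX w
  generalize trailingX w = n at hw
  subst hw
  simp

/-- `∂ₓᵏ w = (w minus its last k letters)` for `k ≤ trailingX w`.
[cite: IharaKanekoZagier2006, Cor. 5] -/
theorem dEnd_iterate_word_of_le_trailingX (w : List Bool) {k : ℕ} (hk : k ≤ trailingX w) :
    (dEnd false)^[k] (word w : ShuffleAlgebra Bool ℚ) = word (w.take (w.length - k)) := by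
  obtain ⟨u₀, hw, -⟩ := eq_append_replicate_trailingX w
  generalize trailingX w = n at hw hk
  subst hw
  obtain ⟨e, rfl⟩ : ∃ e, n = e + k := ⟨n - k, by omega⟩
  rw [List.replicate_add, ← List.append_assoc]
  have hlen : (u₀ ++ List.replicate e false ++ List.replicate k false).length - k =
      (u₀ ++ List.replicate e false).length := by
    simp only [List.length_append, List.length_replicate]; omega
  rw [hlen, List.take_left]
  ext v
  rw [dEnd_iterate_apply, word_apply, word_apply]
  simp only [List.append_cancel_right_eq]

/-- `∂ₓᵏ w = 0` for `k > trailingX w`. [cite: IharaKanekoZagier2006, Cor. 5] -/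
theorem dEnd_iterate_word_of_trailingX_lt (w : List Bool) {k : ℕ} (hk : trailingX w < k) :
    (dEnd false)^[k] (word w : ShuffleAlgebra Bool ℚ) = 0 := by
  obtain ⟨u₀, hw, hu₀⟩ := eq_append_replicate_trailingX w
  generalize trailingX w = n at hw hk
  subst hw
  ext v
  rw [dEnd_iterate_apply, word_apply, zero_apply, if_neg]
  intro h
  apply hu₀
  obtain ⟨d, rfl⟩ : ∃ d, k = d + 1 + n := ⟨k - n - 1, by omega⟩
  rw [List.replicate_add, ← List.append_assoc, List.append_cancel_right_eq] at h
  rw [← h, List.replicate_succ', ← List.append_assoc]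
  simp

/-- **The tree's `MZV.regEnd` is the end Taylor map**: `regEnd w = τ^{end}_{|w|+1}(w)`
coefficientwise. [cite: IharaKanekoZagier2006, Cor. 5] -/
theorem regEnd_apply (w v : List Bool) : MZV.regEnd w v = regE w v := by
  rw [MZV.regEnd, Finsupp.finsetSum_apply, regE, TaylorSystem.taylor, finset_sum_apply]
  symm
  have hsub : Finset.range (trailingX w + 1) ⊆ Finset.range (w.length + 1) :=
    Finset.range_mono (Nat.succ_le_succ (trailingX_le_length w))
  refine ((Finset.sum_subset hsub fun k hk hk' => ?_).symm).trans
    (Finset.sum_congr rfl fun k hk => ?_)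
  · rw [Finset.mem_range] at hk hk'
    rw [neg_one_pow_mul_apply, endSystem_t, endSystem_D,
      dEnd_iterate_word_of_trailingX_lt w (by omega), mul_zero, zero_apply, mul_zero]
  · rw [Finset.mem_range, Nat.lt_succ_iff] at hk
    rw [Finsupp.smul_apply, shuffleSum_apply, neg_one_pow_mul_apply, endSystem_t, endSystem_D,
      dEnd_iterate_word_of_le_trailingX w hk, smul_eq_mul]

/-- Structure of a word along its leading block of `y`'s: `w = y^{leadingY w} w₀` with `w₀` not
beginning with `y`. [cite: IharaKanekoZagier2006, Cor. 5 (w = yᵐ w₀)] -/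
theorem eq_replicate_leadingY_append : ∀ w : List Bool,
    ∃ w₀ : List Bool, w = List.replicate (leadingY w) true ++ w₀ ∧ w₀.head? ≠ some true
  | [] => ⟨[], by simp [MZV.leadingY]⟩
  | false :: w => ⟨false :: w, by simp [MZV.leadingY]⟩
  | true :: w => by
    obtain ⟨w₀, hw, h0⟩ := eq_replicate_leadingY_append w
    have h1 : leadingY (true :: w) = leadingY w + 1 := by simp [MZV.leadingY]
    refine ⟨w₀, ?_, h0⟩
    rw [h1, List.replicate_succ, List.cons_append, ← hw]

/-- `leadingY w ≤ |w|`. [folklore] -/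
theorem leadingY_le_length (w : List Bool) : leadingY w ≤ w.length := by
  obtain ⟨w₀, hw, -⟩ := eq_replicate_leadingY_append w
  generalize leadingY w = m at hw
  subst hw
  simp

/-- `ᵧ∂ⁱ w = (w minus its first i letters)` for `i ≤ leadingY w`.
[cite: IharaKanekoZagier2006, Cor. 5] -/
theorem dFront_iterate_word_of_le_leadingY (w : List Bool) {i : ℕ} (hi : i ≤ leadingY w) :
    (dFront true)^[i] (word w : ShuffleAlgebra Bool ℚ) = word (w.drop i) := by
  obtain ⟨w₀, hw, -⟩ := eq_replicate_leadingY_append w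
  generalize leadingY w = m at hw hi
  subst hw
  obtain ⟨e, rfl⟩ : ∃ e, m = i + e := ⟨m - i, by omega⟩
  rw [List.replicate_add, List.append_assoc, List.drop_left' (List.length_replicate ..)]
  ext v
  rw [dFront_iterate_apply, word_apply, word_apply]
  simp only [List.append_cancel_left_eq]

/-- `ᵧ∂ⁱ w = 0` for `i > leadingY w`. [cite: IharaKanekoZagier2006, Cor. 5] -/
theorem dFront_iterate_word_of_leadingY_lt (w : List Bool) {i : ℕ} (hi : leadingY w < i) :
    (dFront true)^[i] (word w : ShuffleAlgebra Bool ℚ) = 0 := by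
  obtain ⟨w₀, hw, hhead⟩ := eq_replicate_leadingY_append w
  generalize leadingY w = m at hw hi
  subst hw
  ext v
  rw [dFront_iterate_apply, word_apply, zero_apply, if_neg]
  intro h
  apply hhead
  obtain ⟨d, rfl⟩ : ∃ d, i = m + (d + 1) := ⟨i - m - 1, by omega⟩
  rw [List.replicate_add, List.append_assoc, List.append_cancel_left_eq] at h
  rw [← h, List.replicate_succ, List.cons_append]
  rfl

/-- **The tree's `MZV.regFront` is the front Taylor map**: `regFront w = τ^{front}_{|w|+1}(w)`
coefficientwise. [cite: IharaKanekoZagier2006, Cor. 5] -/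
theorem regFront_apply (w v : List Bool) : MZV.regFront w v = regF w v := by
  rw [MZV.regFront, Finsupp.finsetSum_apply, regF, TaylorSystem.taylor, finset_sum_apply]
  symm
  have hsub : Finset.range (leadingY w + 1) ⊆ Finset.range (w.length + 1) :=
    Finset.range_mono (Nat.succ_le_succ (leadingY_le_length w))
  refine ((Finset.sum_subset hsub fun i hi hi' => ?_).symm).trans
    (Finset.sum_congr rfl fun i hi => ?_)
  · rw [Finset.mem_range] at hi hi'
    rw [neg_one_pow_mul_apply, frontSystem_t, frontSystem_D,
      dFront_iterate_word_of_leadingY_lt w (by omega), mul_zero, zero_apply, mul_zero]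
  · rw [Finset.mem_range, Nat.lt_succ_iff] at hi
    rw [Finsupp.smul_apply, shuffleSum_apply, neg_one_pow_mul_apply, frontSystem_t, frontSystem_D,
      dFront_iterate_word_of_le_leadingY w hi, smul_eq_mul]

/-- `regE w` expanded on the (finite) support of `MZV.regEnd w`. [folklore] -/
theorem regE_eq_sum_support (w : List Bool) :
    regE w = ∑ u ∈ (MZV.regEnd w).support, C (MZV.regEnd w u) * word u := by
  ext v
  rw [finset_sum_apply]
  simp only [C_mul_apply, word_apply, mul_ite, mul_one, mul_zero]
  rw [Finset.sum_ite_eq]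
  split_ifs with h
  · exact (regEnd_apply w v).symm
  · rw [Finsupp.mem_support_iff, not_not] at h
    rw [← regEnd_apply, h]

/-- **The tree's `MZV.shuffleReg` is the two-sided Taylor map**: `shuffleReg w = reg w`
coefficientwise. [cite: IharaKanekoZagier2006, §3 (reg_ш) and Cor. 5] -/
theorem shuffleReg_apply (w v : List Bool) : MZV.shuffleReg w v = reg w v := by
  rw [MZV.shuffleReg, Finsupp.sum, Finsupp.finsetSum_apply]
  simp only [Finsupp.smul_apply, smul_eq_mul, regFront_apply]
  rw [reg, regE_eq_sum_support, TaylorSystem.taylor_sum, finset_sum_apply]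
  refine Finset.sum_congr rfl fun u hu => ?_
  rw [(frontSystem true).taylor_mul_left_of_D_eq_zero
      (by rw [frontSystem_D]; exact dFront_C true _), C_mul_apply, regF]
  congr 1
  have hlen : u.length ≤ w.length := by
    by_contra hlt
    exact (Finsupp.mem_support_iff.1 hu)
      (by rw [regEnd_apply]; exact regE_apply_eq_zero_of_length_lt w u (not_le.1 hlt))
  rw [(frontSystem true).taylor_eq_of_le (dFront_iterate_word_eq_zero true u)
    (Nat.succ_le_succ hlen)]

end Reg

end ShuffleAlgebra

/-! ## Consequences for `MZV.shuffleReg` -/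

namespace MZV

/-- **`reg_ш` lands in `𝔥⁰`**: every word in the support of `MZV.shuffleReg w` is convergent.
[cite: IharaKanekoZagier2006, §3 p. 314] -/
theorem isConvergentWord_of_mem_support_shuffleReg {w v : List Bool}
    (hv : v ∈ (shuffleReg w).support) : IsConvergentWord v := by
  rw [Finsupp.mem_support_iff, ShuffleAlgebra.shuffleReg_apply] at hv
  exact ShuffleAlgebra.isConvergentWord_of_reg_apply_ne_zero hv

/-- Words in the support of `MZV.shuffleReg w` are not longer than `w`. [folklore] -/
theorem length_le_of_mem_support_shuffleReg {w v : List Bool}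
    (hv : v ∈ (shuffleReg w).support) : v.length ≤ w.length := by
  rw [Finsupp.mem_support_iff, ShuffleAlgebra.shuffleReg_apply] at hv
  by_contra h
  exact hv (ShuffleAlgebra.reg_apply_eq_zero_of_length_lt w v (not_le.1 h))

/-- **`reg_ш` is a shuffle homomorphism**, coefficientwise through deshuffles:
`Σ_{w ∈ u ш v} reg(w)(r) = Σ_{(p,q) ∈ deshuffle r} reg(u)(p) reg(v)(q)` (`= (reg u ш reg v)(r)`).
[cite: IharaKanekoZagier2006, §3 p. 314] -/
theorem sum_map_shuffleReg_apply (u v r : List Bool) :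
    ((shuffleWord u v).map fun w => shuffleReg w r).sum =
      ((NCSeries.deshuffle r).map fun p => shuffleReg u p.1 * shuffleReg v p.2).sum := by
  simp only [ShuffleAlgebra.shuffleReg_apply]
  rw [← ShuffleAlgebra.mul_apply, ← ShuffleAlgebra.reg_mul, ShuffleAlgebra.list_sum_apply,
    List.map_map]
  rfl

end MZV

/-! ## Multiplicativity of `reg_ш` in the Finsupp language of `MZVShuffleRegularisation.lean` -/

namespace MZV

/-- `reg w` expanded on the (finite) support of `MZV.shuffleReg w`, as an element of the completed
shuffle algebra. [folklore] -/
theorem reg_eq_sum_support (w : List Bool) :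
    ShuffleAlgebra.reg w =
      ∑ p ∈ (shuffleReg w).support, ShuffleAlgebra.C (shuffleReg w p) * ShuffleAlgebra.word p := by
  ext v
  rw [ShuffleAlgebra.finset_sum_apply]
  simp only [ShuffleAlgebra.C_mul_apply, ShuffleAlgebra.word_apply, mul_ite, mul_one, mul_zero]
  rw [Finset.sum_ite_eq]
  split_ifs with h
  · exact (ShuffleAlgebra.shuffleReg_apply w v).symm
  · rw [Finsupp.mem_support_iff, not_not] at h
    rw [← ShuffleAlgebra.shuffleReg_apply, h]

/-- `shuffleRegFS` is additive. [folklore] -/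
theorem shuffleRegFS_add (f g : List Bool →₀ ℚ) :
    shuffleRegFS (f + g) = shuffleRegFS f + shuffleRegFS g :=
  Finsupp.sum_add_index' (fun _ => zero_smul _ _) (fun _ _ _ => add_smul _ _ _)

/-- `shuffleRegFS` on a single word. [folklore] -/
theorem shuffleRegFS_single (w : List Bool) (a : ℚ) : shuffleRegFS (Finsupp.single w a) = a • shuffleReg w :=
  Finsupp.sum_single_index (zero_smul _ _)

/-- `shuffleRegFS (Σ_{w ∈ L} w) = Σ_{w ∈ L} shuffleReg w`. [folklore] -/
theorem shuffleRegFS_wordSum (L : List (List Bool)) :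
    shuffleRegFS (wordSum L) = (L.map shuffleReg).sum := by
  induction L with
  | nil => simp [shuffleRegFS]
  | cons w L ih => rw [wordSum_cons, shuffleRegFS_add, shuffleRegFS_single, one_smul, ih,
      List.map_cons, List.sum_cons]

/-- The bilinear shuffle product of `𝔥`, coefficientwise. [folklore] -/
theorem shuffleFS_apply (f g : List Bool →₀ ℚ) (r : List Bool) :
    shuffleFS f g r = ∑ p ∈ f.support, ∑ q ∈ g.support, f p * g q * shuffleSum p q r := by
  rw [shuffleFS, Finsupp.sum, Finsupp.finsetSum_apply]
  refine Finset.sum_congr rfl fun p _ => ?_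
  rw [Finsupp.sum, Finsupp.finsetSum_apply]
  refine Finset.sum_congr rfl fun q _ => ?_
  rw [Finsupp.smul_apply, smul_eq_mul]

/-- A list sum of elements of `𝔥`, coefficientwise. [folklore] -/
theorem finsupp_list_sum_apply (L : List (List Bool →₀ ℚ)) (r : List Bool) :
    L.sum r = (L.map fun f => f r).sum := by
  induction L with
  | nil => rfl
  | cons f L ih => rw [List.sum_cons, List.map_cons, List.sum_cons, Finsupp.add_apply, ih]

/-- **`reg_ш(u ш v) = reg_ш(u) ш reg_ш(v)`** in the Finsupp language of
`MZVShuffleRegularisation.lean` (`𝔥 = List Bool →₀ ℚ`, `shuffleFS`, `shuffleRegFS`): the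
multiplicativity "NOT proved" there, announced as wanted by route
KontsevichZagierPeriods/FurushoPentagon. [cite: IharaKanekoZagier2006, §3 p. 314] -/
theorem shuffleRegFS_shuffleSum (u v : List Bool) :
    shuffleRegFS (shuffleSum u v) = shuffleFS (shuffleReg u) (shuffleReg v) := by
  ext r
  rw [shuffleSum, shuffleRegFS_wordSum, finsupp_list_sum_apply, List.map_map, shuffleFS_apply]
  have h1 : ((shuffleWord u v).map ((fun f : List Bool →₀ ℚ => f r) ∘ shuffleReg)).sum =
      ((shuffleWord u v).map fun w => shuffleReg w r).sum := rfl
  rw [h1, sum_map_shuffleReg_apply]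
  simp only [ShuffleAlgebra.shuffleSum_apply, ShuffleAlgebra.shuffleReg_apply]
  rw [← ShuffleAlgebra.mul_apply]
  conv_lhs => rw [reg_eq_sum_support u, reg_eq_sum_support v]
  rw [Finset.sum_mul_sum, ShuffleAlgebra.finset_sum_apply]
  refine Finset.sum_congr rfl fun p _ => ?_
  rw [ShuffleAlgebra.finset_sum_apply]
  refine Finset.sum_congr rfl fun q _ => ?_
  rw [mul_mul_mul_comm, ← ShuffleAlgebra.C_mul, ShuffleAlgebra.C_mul_apply,
    ShuffleAlgebra.shuffleReg_apply, ShuffleAlgebra.shuffleReg_apply]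

end MZV

end Literature.NumberTheory.Transcendental
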